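import Mathlib.MeasureTheory.Integral.DominatedConvergence
import Summits.RiemannHypothesis.RiemannHypothesis.Theorems.SoninSignTent
import HarnessLib

/-!
# The Sonin sign mechanism, II — concave nondecreasing kernels are conditionally negative definite

Second file of the chain (seat cc-s2-1 gen 6, Lean lane item L1).  With the pair form
`⟨k⟩_G := ∫_{ℝ²} k(u−v) G(u) conj G(v)` (written out as a product integral in every statement):
* `pairP_tent` — `⟨(s − |·|)₊⟩_G = ∫ ‖H_s‖²` (product form of the tent identity);
* `pairP_const` — `⟨s⟩_G = s·(∫G)·conj(∫G)`;
* `pairP_min` — **truncated distance is conditionally negative definite**: for `∫G = 0`,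
  `⟨min(|·|, s)⟩_G = −∫‖H_s‖² ≤ 0`;
* `pairP_mixture` — the ramp-mixture swap `⟨∫₀ᴿ w(s)min(|·|,s)ds⟩_G = ∫₀ᴿ w(s)⟨min(|·|,s)⟩_G ds`
  (Fubini on `ℝ² × ℝ`);
* `re_pairP_nonpos_of_concave` — **the CND theorem**: if `φ(r) = ∫₀ʳ ψ` with `ψ ∈ C¹`, `ψ′ ≤ 0` on
  `[0, R]`, `ψ(R) ≥ 0` (`φ(0) = 0`, `φ` nondecreasing and concave on `[0,R]`), then for every continuous
  `G` supported in an interval of length `R` with `∫G = 0`: `Re ∫∫ φ(|u−v|) G(u) conj G(v) ≤ 0`.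
  (Schoenberg 1938 / Pólya 1949 give this via Bochner; the proof here is
  `φ(r) = φ′(R)r + ∫(r∧s)(−φ″)`, `r∧s = s − 1_{[0,s]}⋆1_{[−s,0]}`, Fubini — no Fourier analysis.)
All PROVED, no named facts.
-/

set_option linter.dupNamespace false  -- the mandated namespace repeats `RiemannHypothesis`

noncomputable section

open MeasureTheory Set intervalIntegral Complex
open scoped ComplexConjugate

namespace Summit.RiemannHypothesis.RiemannHypothesis.SoninSign

variable {G : ℝ → ℂ}

/-- Integrability of the pair integrand for a continuous kernel. [folklore] -/
theorem integrable_pair (hG : Continuous G) (hGs : HasCompactSupport G) {k : ℝ → ℝ} (hk : Continuous k) :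
    Integrable (fun p : ℝ × ℝ => ((k (p.1 - p.2) : ℝ) : ℂ) * (G p.1 * conj (G p.2))) := by
  refine Continuous.integrable_of_hasCompactSupport ?_ (hasCompactSupport_pair hGs (fun x => ((k x : ℝ) : ℂ)))
  exact (Complex.continuous_ofReal.comp (hk.comp (continuous_fst.sub continuous_snd))).mul
    ((hG.comp continuous_fst).mul (Complex.continuous_conj.comp (hG.comp continuous_snd)))

/-- The tent identity in product form: `⟨(s − |·|)₊⟩_G = ∫ ‖H_s‖²`. [folklore] -/
private theorem pairP_tent (hG : Continuous G) (hGs : HasCompactSupport G) (s : ℝ) :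
    (∫ p : ℝ × ℝ, ((max (s - |p.1 - p.2|) 0 : ℝ) : ℂ) * (G p.1 * conj (G p.2))) = ((∫ w, ‖(∫ u in Icc (w - s) w, G u)‖ ^ 2 : ℝ) : ℂ) :=
  integral_prod_tent_eq hG hGs s

/-- A constant kernel sees only `|∫G|²`: `⟨s⟩_G = s·(∫G)·conj(∫G)`. [folklore] -/
private theorem pairP_const (G : ℝ → ℂ) (s : ℝ) :
    (∫ p : ℝ × ℝ, ((s : ℝ) : ℂ) * (G p.1 * conj (G p.2))) = (s : ℂ) * ((∫ u, G u) * conj (∫ v, G v)) := by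
  rw [MeasureTheory.integral_const_mul, ← integral_conj, ← MeasureTheory.integral_prod_mul]
  rfl

/-- `min(|x|, s) = s − (s − |x|)₊`. [folklore] -/
theorem min_abs_eq_sub_tent (x s : ℝ) : min |x| s = s - max (s - |x|) 0 := by
  rcases le_total |x| s with h | h
  · rw [min_eq_left h, max_eq_left (by linarith)]; ring
  · rw [min_eq_right h, max_eq_right (by linarith)]; ring

/-- **Truncated distance is conditionally negative definite**: for `∫G = 0`,
`⟨min(|·|, s)⟩_G = −∫‖H_s‖²`. [folklore] -/
private theorem pairP_min (hG : Continuous G) (hGs : HasCompactSupport G) (h0 : ∫ u, G u = 0) (s : ℝ) :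
    (∫ p : ℝ × ℝ, ((min |p.1 - p.2| s : ℝ) : ℂ) * (G p.1 * conj (G p.2))) = -(((∫ w, ‖(∫ u in Icc (w - s) w, G u)‖ ^ 2 : ℝ) : ℂ)) := by
  have I1 : Integrable (fun p : ℝ × ℝ => ((s : ℝ) : ℂ) * (G p.1 * conj (G p.2))) :=
    integrable_pair hG hGs (k := fun _ => s) continuous_const
  have I2 : Integrable (fun p : ℝ × ℝ => ((max (s - |p.1 - p.2|) 0 : ℝ) : ℂ) * (G p.1 * conj (G p.2))) :=
    integrable_pair hG hGs (k := fun x => max (s - |x|) 0)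
      ((continuous_const.sub continuous_abs).max continuous_const)
  have h1 : (∫ p : ℝ × ℝ, ((min |p.1 - p.2| s : ℝ) : ℂ) * (G p.1 * conj (G p.2))) = (∫ p : ℝ × ℝ, ((s : ℝ) : ℂ) * (G p.1 * conj (G p.2))) - (∫ p : ℝ × ℝ, ((max (s - |p.1 - p.2|) 0 : ℝ) : ℂ) * (G p.1 * conj (G p.2))) := by
    rw [← integral_sub I1 I2]
    refine integral_congr_ae (Filter.Eventually.of_forall fun p => ?_)
    simp only [min_abs_eq_sub_tent]
    push_cast
    ring
  rw [h1, pairP_const, h0, zero_mul, mul_zero, zero_sub, pairP_tent hG hGs]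

/-- Integrability of the mixture integrand on `ℝ² × ℝ` (bounded, supported in a compact box). [folklore] -/
private theorem integrable_mixF (hG : Continuous G) (hGs : HasCompactSupport G) {w : ℝ → ℝ} (hw : Continuous w)
    (R : ℝ) :
    Integrable (Function.uncurry (fun (p : ℝ × ℝ) (s : ℝ) => ((((Ioc 0 R).indicator (fun s => w s * min |p.1 - p.2| s) s : ℝ) : ℂ) * (G p.1 * conj (G p.2)))))
      (((volume : Measure ℝ).prod (volume : Measure ℝ)).prod (volume : Measure ℝ)) := by
  obtain ⟨C, hC⟩ := hG.bounded_above_of_compact_support hGs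
  obtain ⟨M, hM⟩ := (hGs.isCompact.isBounded).subset_closedBall 0
  obtain ⟨Cw, hCw⟩ := isCompact_Icc.exists_bound_of_continuousOn (hw.continuousOn (s := Icc 0 R))
  have hsuppG : ∀ x, G x ≠ 0 → x ∈ Icc (-M) M := by
    intro x hx
    have := hM (subset_tsupport G hx)
    rwa [Real.closedBall_eq_Icc, zero_sub, zero_add] at this
  set box : Set ((ℝ × ℝ) × ℝ) := (Icc (-M) M ×ˢ Icc (-M) M) ×ˢ Icc 0 R with hbox
  have hbox_fin : (((volume : Measure ℝ).prod (volume : Measure ℝ)).prod (volume : Measure ℝ)) box ≠ ⊤ := by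
    rw [hbox, Measure.prod_prod, Measure.prod_prod]
    exact ENNReal.mul_ne_top (ENNReal.mul_ne_top measure_Icc_lt_top.ne measure_Icc_lt_top.ne)
      measure_Icc_lt_top.ne
  -- measurability
  have hmeas : Measurable (Function.uncurry (fun (p : ℝ × ℝ) (s : ℝ) => ((((Ioc 0 R).indicator (fun s => w s * min |p.1 - p.2| s) s : ℝ) : ℂ) * (G p.1 * conj (G p.2))))) := by
    have h1 : Measurable (fun q : (ℝ × ℝ) × ℝ => (Ioc 0 R).indicator (fun s => w s * min |q.1.1 - q.1.2| s) q.2) := by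
      have : (fun q : (ℝ × ℝ) × ℝ => (Ioc 0 R).indicator (fun s => w s * min |q.1.1 - q.1.2| s) q.2) =
          fun q => ({q : (ℝ × ℝ) × ℝ | q.2 ∈ Ioc 0 R}).indicator
            (fun q => w q.2 * min |q.1.1 - q.1.2| q.2) q := by
        funext q
        by_cases hq : q.2 ∈ Ioc 0 R
        · rw [Set.indicator_of_mem hq, Set.indicator_of_mem (show q ∈ {q : (ℝ × ℝ) × ℝ | q.2 ∈ Ioc 0 R} from hq)]
        · rw [Set.indicator_of_notMem hq, Set.indicator_of_notMem (show q ∉ {q : (ℝ × ℝ) × ℝ | q.2 ∈ Ioc 0 R} from hq)]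
      rw [this]
      refine Measurable.indicator ?_ (measurableSet_Ioc.preimage measurable_snd)
      exact ((hw.comp continuous_snd).mul
        (((continuous_fst.fst.sub continuous_fst.snd).abs).min continuous_snd)).measurable
    exact (Complex.measurable_ofReal.comp h1).mul
      ((hG.measurable.comp measurable_fst.fst).mul
        (Complex.continuous_conj.measurable.comp (hG.measurable.comp measurable_fst.snd)))
  -- support
  have hzero : ∀ q : (ℝ × ℝ) × ℝ, q ∉ box → Function.uncurry (fun (p : ℝ × ℝ) (s : ℝ) => ((((Ioc 0 R).indicator (fun s => w s * min |p.1 - p.2| s) s : ℝ) : ℂ) * (G p.1 * conj (G p.2)))) q = 0 := by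
    intro q hq
    simp only [Function.uncurry]
    by_contra hne
    have h1 : G q.1.1 ≠ 0 := by intro h0; apply hne; simp [h0]
    have h2 : G q.1.2 ≠ 0 := by intro h0; apply hne; simp [h0]
    have hs : q.2 ∈ Ioc 0 R := by
      by_contra hs; apply hne; simp [Set.indicator_of_notMem hs]
    apply hq
    rw [hbox, Set.mem_prod, Set.mem_prod]
    exact ⟨⟨hsuppG _ h1, hsuppG _ h2⟩, ⟨hs.1.le, hs.2⟩⟩
  -- bound
  have hC0 : 0 ≤ C := (norm_nonneg _).trans (hC 0)
  have hbound : ∀ q : (ℝ × ℝ) × ℝ, ‖Function.uncurry (fun (p : ℝ × ℝ) (s : ℝ) => ((((Ioc 0 R).indicator (fun s => w s * min |p.1 - p.2| s) s : ℝ) : ℂ) * (G p.1 * conj (G p.2)))) q‖ ≤ |Cw| * |R| * (C * C) := by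
    intro q
    simp only [Function.uncurry]
    rw [norm_mul, norm_mul, Complex.norm_real, Real.norm_eq_abs, Complex.norm_conj]
    have hind : |(Ioc 0 R).indicator (fun s => w s * min |q.1.1 - q.1.2| s) q.2| ≤ |Cw| * |R| := by
      by_cases hq : q.2 ∈ Ioc 0 R
      · rw [Set.indicator_of_mem hq, abs_mul]
        have hmin : |min |q.1.1 - q.1.2| q.2| ≤ |R| := by
          rw [abs_of_nonneg (le_min (abs_nonneg _) hq.1.le)]
          exact (min_le_right _ _).trans (hq.2.trans (le_abs_self R))
        exact mul_le_mul ((hCw q.2 ⟨hq.1.le, hq.2⟩).trans (le_abs_self _)) hmin (abs_nonneg _)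
          (abs_nonneg _)
      · rw [Set.indicator_of_notMem hq, abs_zero]; positivity
    have hGG : ‖G q.1.1‖ * ‖G q.1.2‖ ≤ C * C := mul_le_mul (hC _) (hC _) (norm_nonneg _) hC0
    exact mul_le_mul hind hGG (mul_nonneg (norm_nonneg _) (norm_nonneg _)) (by positivity)
  have hIntOn : IntegrableOn (Function.uncurry (fun (p : ℝ × ℝ) (s : ℝ) => ((((Ioc 0 R).indicator (fun s => w s * min |p.1 - p.2| s) s : ℝ) : ℂ) * (G p.1 * conj (G p.2))))) box
      (((volume : Measure ℝ).prod (volume : Measure ℝ)).prod (volume : Measure ℝ)) :=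
    Measure.integrableOn_of_bounded hbox_fin hmeas.aestronglyMeasurable
      (Filter.Eventually.of_forall hbound)
  exact hIntOn.integrable_of_ae_notMem_eq_zero (Filter.Eventually.of_forall hzero)

/-- **Mixture swap**: `⟨∫₀ᴿ w(s) min(|·|,s) ds⟩_G = ∫₀ᴿ w(s) ⟨min(|·|,s)⟩_G ds` (Fubini on `ℝ² × ℝ`). [folklore] -/
private theorem pairP_mixture (hG : Continuous G) (hGs : HasCompactSupport G) {w : ℝ → ℝ} (hw : Continuous w)
    {R : ℝ} (hR : 0 ≤ R) :
    (∫ p : ℝ × ℝ, ((∫ s in (0:ℝ)..R, w s * min |p.1 - p.2| s : ℝ) : ℂ) * (G p.1 * conj (G p.2))) =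
      ∫ s in (0:ℝ)..R, ((w s : ℝ) : ℂ) * (∫ p : ℝ × ℝ, ((min |p.1 - p.2| s : ℝ) : ℂ) * (G p.1 * conj (G p.2))) := by
  -- the left side as an iterated integral of the mixture integrand
  have hL : (∫ p : ℝ × ℝ, ((∫ s in (0:ℝ)..R, w s * min |p.1 - p.2| s : ℝ) : ℂ) * (G p.1 * conj (G p.2))) =
      ∫ p : ℝ × ℝ, ∫ s, ((((Ioc 0 R).indicator (fun s => w s * min |p.1 - p.2| s) s : ℝ) : ℂ) * (G p.1 * conj (G p.2))) := by
    refine integral_congr_ae (Filter.Eventually.of_forall fun p => ?_)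
    beta_reduce
    rw [MeasureTheory.integral_mul_const, integral_complex_ofReal, MeasureTheory.integral_indicator measurableSet_Ioc,
      ← intervalIntegral.integral_of_le hR]
  -- the right side as an iterated integral of the mixture integrand
  have hRt : (∫ s in (0:ℝ)..R, ((w s : ℝ) : ℂ) * (∫ p : ℝ × ℝ, ((min |p.1 - p.2| s : ℝ) : ℂ) * (G p.1 * conj (G p.2)))) =
      ∫ s, ∫ p : ℝ × ℝ, ((((Ioc 0 R).indicator (fun s => w s * min |p.1 - p.2| s) s : ℝ) : ℂ) * (G p.1 * conj (G p.2))) := by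
    rw [intervalIntegral.integral_of_le hR, ← MeasureTheory.integral_indicator measurableSet_Ioc]
    refine integral_congr_ae (Filter.Eventually.of_forall fun s => ?_)
    by_cases hs : s ∈ Ioc 0 R
    · rw [Set.indicator_of_mem hs]
      rw [← MeasureTheory.integral_const_mul]
      refine integral_congr_ae (Filter.Eventually.of_forall fun p => ?_)
      simp only [Set.indicator_of_mem hs]
      push_cast
      ring
    · rw [Set.indicator_of_notMem hs]
      have : (fun p : ℝ × ℝ => ((((Ioc 0 R).indicator (fun s => w s * min |p.1 - p.2| s) s : ℝ) : ℂ) * (G p.1 * conj (G p.2)))) = fun _ => 0 := by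
        funext p; simp only [Set.indicator_of_notMem hs]; simp
      beta_reduce
      rw [this, MeasureTheory.integral_zero]
  rw [hL, hRt]
  exact MeasureTheory.integral_integral_swap (integrable_mixF hG hGs hw R)

/-- The energy `N(s) = ∫ ‖H_s‖²` is nonnegative. [folklore] -/
theorem windowEnergy_nonneg (G : ℝ → ℂ) (s : ℝ) : 0 ≤ ∫ w, ‖(∫ u in Icc (w - s) w, G u)‖ ^ 2 :=
  integral_nonneg fun _ => sq_nonneg _

/-- **Concave nondecreasing kernels vanishing at the origin are conditionally negative definite on
windows** (Pólya–Schoenberg type; elementary proof via the ramp decomposition): if `φ(r) = ∫₀ʳ ψ` with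
`ψ ∈ C¹`, `ψ′ ≤ 0` on `[0,R]` and `ψ(R) ≥ 0` (so `φ(0) = 0`, `φ` nondecreasing and concave on `[0,R]`),
then for every continuous `G` supported in an interval of length `R` with `∫ G = 0`:
`Re ∫∫ φ(|u−v|) G(u) conj G(v) ≤ 0`. [cite: Schoenberg1938, Thm. 2 (metric transforms / conditionally negative definite kernels); Polya1949 (convexity criterion)] -/
theorem re_integral_prod_kernel_nonpos_of_concave {ψ : ℝ → ℝ} (hψ : ContDiff ℝ 1 ψ) {R : ℝ}
    (hR : 0 ≤ R) (hψR : 0 ≤ ψ R) (hψ' : ∀ s ∈ Icc 0 R, deriv ψ s ≤ 0)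
    (hG : Continuous G) (hGs : HasCompactSupport G) {c : ℝ} (hsupp : tsupport G ⊆ Icc c (c + R))
    (h0 : ∫ u, G u = 0) :
    (∫ p : ℝ × ℝ, ((∫ t in (0:ℝ)..|p.1 - p.2|, ψ t : ℝ) : ℂ) * (G p.1 * conj (G p.2))).re ≤ 0 := by
  set P : (ℝ → ℝ) → ℂ := fun k => ∫ p : ℝ × ℝ, ((k (p.1 - p.2) : ℝ) : ℂ) * (G p.1 * conj (G p.2)) with hP
  change (P (fun x => ∫ t in (0:ℝ)..|x|, ψ t)).re ≤ 0
  have hψ'c : Continuous (deriv ψ) := hψ.continuous_deriv le_rfl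
  set N : ℝ → ℝ := fun s => ∫ w, ‖(∫ u in Icc (w - s) w, G u)‖ ^ 2 with hN
  -- Step 1: replace the kernel by its ramp decomposition (they agree wherever G(u) conj G(v) ≠ 0)
  have hrepl : P (fun x => ∫ t in (0:ℝ)..|x|, ψ t) =
      P (fun x => ψ R * min |x| R + ∫ s in (0:ℝ)..R, (-deriv ψ s) * min |x| s) := by
    simp only [hP]
    refine integral_congr_ae (Filter.Eventually.of_forall fun p => ?_)
    show (((∫ t in (0:ℝ)..|p.1 - p.2|, ψ t : ℝ)) : ℂ) * (G p.1 * conj (G p.2)) =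
      (((ψ R * min |p.1 - p.2| R + ∫ s in (0:ℝ)..R, (-deriv ψ s) * min |p.1 - p.2| s : ℝ)) : ℂ) *
        (G p.1 * conj (G p.2))
    by_cases hp : G p.1 * conj (G p.2) = 0
    · simp [hp]
    · have h1 : G p.1 ≠ 0 := fun h => hp (by simp [h])
      have h2 : G p.2 ≠ 0 := fun h => hp (by simp [h])
      have hu := hsupp (subset_tsupport G h1)
      have hv := hsupp (subset_tsupport G h2)
      have hr : |p.1 - p.2| ≤ R := abs_le.2 ⟨by linarith [hu.1, hv.2], by linarith [hu.2, hv.1]⟩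
      congr 2
      rw [integral_eq_mul_add_integral_min_mul_neg_deriv hψ (abs_nonneg _) hr, min_eq_left hr]
      congr 1
      exact intervalIntegral.integral_congr fun s _ => by ring
  -- Step 2: split
  have hk2c : Continuous (fun x : ℝ => ∫ s in (0:ℝ)..R, (-deriv ψ s) * min |x| s) :=
    intervalIntegral.continuous_parametric_intervalIntegral_of_continuous'
      (f := fun x s => (-deriv ψ s) * min |x| s)
      ((hψ'c.comp continuous_snd).neg.mul ((continuous_fst.abs).min continuous_snd)) 0 R
  have I1 : Integrable (fun p : ℝ × ℝ => ((ψ R * min |p.1 - p.2| R : ℝ) : ℂ) * (G p.1 * conj (G p.2))) :=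
    integrable_pair hG hGs (k := fun x => ψ R * min |x| R)
      (continuous_const.mul (continuous_abs.min continuous_const))
  have I2 : Integrable (fun p : ℝ × ℝ =>
      ((∫ s in (0:ℝ)..R, (-deriv ψ s) * min |p.1 - p.2| s : ℝ) : ℂ) * (G p.1 * conj (G p.2))) :=
    integrable_pair hG hGs (k := fun x => ∫ s in (0:ℝ)..R, (-deriv ψ s) * min |x| s) hk2c
  have hsplit1 : P (fun x => ψ R * min |x| R + ∫ s in (0:ℝ)..R, (-deriv ψ s) * min |x| s) =
      P (fun x => ψ R * min |x| R) +
        P (fun x => ∫ s in (0:ℝ)..R, (-deriv ψ s) * min |x| s) := by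
    simp only [hP]
    rw [← integral_add I1 I2]
    refine integral_congr_ae (Filter.Eventually.of_forall fun p => ?_)
    show (((ψ R * min |p.1 - p.2| R + ∫ s in (0:ℝ)..R, (-deriv ψ s) * min |p.1 - p.2| s : ℝ)) : ℂ) *
        (G p.1 * conj (G p.2)) = _
    push_cast
    ring
  have hsplit2 : P (fun x => ψ R * min |x| R) = (ψ R : ℂ) * P (fun x => min |x| R) := by
    simp only [hP]
    rw [← MeasureTheory.integral_const_mul]
    refine integral_congr_ae (Filter.Eventually.of_forall fun p => ?_)
    show (((ψ R * min |p.1 - p.2| R : ℝ)) : ℂ) * (G p.1 * conj (G p.2)) = _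
    push_cast
    ring
  -- Step 3: evaluate the pieces
  have hmin : ∀ s, P (fun x => min |x| s) = -((N s : ℝ) : ℂ) := fun s => by simp only [hP]; exact pairP_min hG hGs h0 s
  have hmix : P (fun x => ∫ s in (0:ℝ)..R, (-deriv ψ s) * min |x| s) =
      ∫ s in (0:ℝ)..R, (((-deriv ψ s : ℝ)) : ℂ) * P (fun x => min |x| s) :=
    by simp only [hP]; exact pairP_mixture hG hGs (w := fun s => -deriv ψ s) hψ'c.neg hR
  have hmixR : P (fun x => ∫ s in (0:ℝ)..R, (-deriv ψ s) * min |x| s) =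
      ((∫ s in (0:ℝ)..R, (-deriv ψ s) * (-N s) : ℝ) : ℂ) := by
    rw [hmix, ← intervalIntegral.integral_ofReal]
    refine intervalIntegral.integral_congr fun s _ => ?_
    simp only [hmin]
    push_cast
    ring
  rw [hrepl, hsplit1, hsplit2, hmin R, hmixR]
  -- Step 4: signs
  have hNR : 0 ≤ N R := windowEnergy_nonneg G R
  have hint : ∫ s in (0:ℝ)..R, (-deriv ψ s) * (-N s) ≤ 0 := by
    have : 0 ≤ ∫ s in (0:ℝ)..R, (-deriv ψ s) * N s :=
      intervalIntegral.integral_nonneg hR fun s hs =>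
        mul_nonneg (neg_nonneg.2 (hψ' s hs)) (windowEnergy_nonneg G s)
    have h2 : ∫ s in (0:ℝ)..R, (-deriv ψ s) * (-N s) = -∫ s in (0:ℝ)..R, (-deriv ψ s) * N s := by
      rw [← intervalIntegral.integral_neg]
      exact intervalIntegral.integral_congr fun s _ => by ring
    linarith
  have hre : ((ψ R : ℂ) * -((N R : ℝ) : ℂ) + ((∫ s in (0:ℝ)..R, (-deriv ψ s) * (-N s) : ℝ) : ℂ)).re =
      ψ R * (-N R) + ∫ s in (0:ℝ)..R, (-deriv ψ s) * (-N s) := by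
    simp [Complex.add_re, Complex.mul_re]
  rw [hre]
  nlinarith

end Summit.RiemannHypothesis.RiemannHypothesis.SoninSign
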